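import Mathlib
import Summits.ValiantsHypothesis.ValiantsHypothesis.Theorems.LacunarySymmetroidMatrixDescartesCensusTropicalKLawSlopes

/-!
# Route «KPlusLogSqLaw», crux `TropicalB` (stmt-ValiantsHypothesis-19771) — EVERY FIXED-CLASS TRUNCATION OF THE DOUBLING STUBS
# `stub_signedDoubling` (threshold `K`) AND `stub_doublingFromSq` (threshold `K²`) IS SLOPE COUNTING (their content is uniformity in `K`)

Calibration file for the lines `Cruxes/TropicalB/Lines/doubling.lean` (stub `stub_signedDoubling`) and `Cruxes/TropicalB/Lines/square_doubling.lean`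
(stub `stub_doublingFromSq`) on the crux `Summit.ValiantsHypothesis.ValiantsHypothesis.Theses.KPlusLogSqLaw.TropicalB`:

* `stub_signedDoubling : ∃ c, ∀ K a e B₁ B₂, K ≤ a → a ≤ e → e ≤ a+1 → TropRootLawAt a K B₁ → TropRootLawAt e K B₂ →
    TropRootLawAt (a+e) K ((a+e)^c · (B₁ + B₂ + 2))`,
* `stub_doublingFromSq` : the same with the threshold `K² ≤ a`.

NO stub is claimed and neither law is proved: this file proves both bodies with the quantifiers `∃ c ∀ K` WEAKENED to `∀ K₀ ∃ c ∀ K ≤ K₀` —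
PARTIAL-RANGE theorems, stated honestly as such (the line card's own remark «the law needs `K ≥ c + 3` before it says anything beyond counting»,
now in the kernel on the stubs' binder shapes).  The half-size hypotheses are idle in this zone: slope counting at the doubled size pays alone.

* `choose_doubled_le_pow` — the arithmetic: `1 ≤ K ≤ K₀`, `K ≤ n` ⇒ `C(K+n−1, n) ≤ n^{2K₀}` (`C(K+n−1, n) = C(K+n−1, K−1) ≤ (K+n−1)^{K−1} ≤ (n²)^{K₀}`,
  as `K+n−1 ≤ 2n − 1 ≤ n²`).
* `tropRootLawAt_doubled_of_bounded_classes (K₀)` — master form: `K ≤ K₀`, `K ≤ a` ⇒ `TropRootLawAt (a+e) K ((a+e)^{2K₀} · (B₁ + B₂ + 2))`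
  for ALL `e, B₁, B₂` (slope counting `tropRootLawAt_choose` at size `a + e`; `K = 0`: no terms / one term).
* ★ `signedDoubling_bounded_classes (K₀)` — the body of `stub_signedDoubling` with `K ≤ K₀` inserted, `c = 2K₀`.
* ★ `doublingFromSq_bounded_classes (K₀)` — the body of `stub_doublingFromSq` with `K ≤ K₀` inserted, `c = 2K₀` (`K ≤ K² ≤ a`).

READING.  Both laws quantify ONE exponent `c` for ALL `K`; every truncation `K ≤ K₀` is slope counting with `c = 2K₀` — so the research content
(and the recorded kill risk «counting-tight `(K,K)`/`(2K,K)` ⇒ ratio `(27/16)^K`») is exactly the UNIFORMITY IN `K`.  Nothing here bears on it.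
HONEST FRAMING: counting bookkeeping; `TropicalB`, the square tower, `stub_tropTowerLog`, `WeakLifting`, Conjecture B, `MatrixDescartes` (18050)
untouched; VP ≠ VNP NOT proved.  Def-free.  Seat: prover leafhand-val-kpluslogsqlaw-1 g2, `--supports stmt-ValiantsHypothesis-19771`.
-/

-- `Summit.ValiantsHypothesis.ValiantsHypothesis.…` repeats a component by the D-0017 layout
-- (single-conjunct summit), which the `dupNamespace` linter flags; the name is mandated.
set_option linter.dupNamespace false

namespace Summit.ValiantsHypothesis.ValiantsHypothesis.Theorems.KPlusLogSqLaw.Doubling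

open Summit.ValiantsHypothesis.ValiantsHypothesis.Theorems.LacunarySymmetroidMatrixDescartes.TropicalCensus

section BoundedClasses

/-- **the arithmetic of the counting zone**: `1 ≤ K ≤ K₀`, `K ≤ n` ⇒ `C(K+n−1, n) ≤ n^{2K₀}`. [this work] -/
theorem choose_doubled_le_pow {K K₀ n : ℕ} (hK1 : 1 ≤ K) (hK : K ≤ K₀) (hKn : K ≤ n) :
    (K + n - 1).choose n ≤ n ^ (2 * K₀) := by
  have hsymm : (K + n - 1).choose n = (K + n - 1).choose (K - 1) := by
    apply Nat.choose_symm_of_eq_add; omega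
  rw [hsymm]
  have hn1 : 1 ≤ n := hK1.trans hKn
  calc (K + n - 1).choose (K - 1) ≤ (K + n - 1) ^ (K - 1) := Nat.choose_le_pow _ _
    _ ≤ (n ^ 2) ^ (K - 1) := by
        apply Nat.pow_le_pow_left
        have h3 : K + n ≤ n ^ 2 + 1 := by nlinarith [hKn, hn1]
        omega
    _ ≤ (n ^ 2) ^ K₀ := Nat.pow_le_pow_right (by positivity) (by omega)
    _ = n ^ (2 * K₀) := by rw [← pow_mul]

/-- **master form of the counting zone for doubling.**  For `K ≤ K₀`, `K ≤ a`, any `e` and ANY `B₁, B₂`: `TropRootLawAt (a+e) K ((a+e)^{2K₀}·(B₁+B₂+2))`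
— slope counting at size `a + e`; the half-size rows and the balance `a ≤ e ≤ a+1` are not needed. [this work; slope counting `tropRootLawAt_choose`] -/
theorem tropRootLawAt_doubled_of_bounded_classes (K₀ : ℕ) {K a : ℕ} (e : ℕ) (hK : K ≤ K₀) (hKa : K ≤ a) (B₁ B₂ : ℕ) :
    TropRootLawAt (a + e) K ((a + e) ^ (2 * K₀) * (B₁ + B₂ + 2)) := by
  refine tropRootLawAt_mono ?_ (tropRootLawAt_choose (a + e) K)
  rcases Nat.eq_zero_or_pos K with hK0 | hK1
  · -- no classes: `C(n − 1, n) ≤ 1`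
    subst hK0
    rcases Nat.eq_zero_or_pos (a + e) with hn | hn
    · rw [hn]; simp
    · have : (0 + (a + e) - 1).choose (a + e) = 0 := Nat.choose_eq_zero_of_lt (by omega)
      rw [this]; simp
  · have hKn : K ≤ a + e := by omega
    have h := choose_doubled_le_pow hK1 hK hKn
    have h1 : (a + e) ^ (2 * K₀) ≤ (a + e) ^ (2 * K₀) * (B₁ + B₂ + 2) := Nat.le_mul_of_pos_right _ (by omega)
    omega

/-- **EVERY FIXED-CLASS TRUNCATION OF `stub_signedDoubling` IS SLOPE COUNTING.**  For every `K₀` there is `c` (namely `2K₀`) such that the body of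
the signed balanced doubling law from size `K` on holds for all `K ≤ K₀`.  (The registered stub asks for ONE `c` for ALL `K` and is NOT proved here.)
[this work] -/
theorem signedDoubling_bounded_classes (K₀ : ℕ) :
    ∃ c : ℕ, ∀ (K a e B₁ B₂ : ℕ), K ≤ K₀ → K ≤ a → a ≤ e → e ≤ a + 1 → TropRootLawAt a K B₁ → TropRootLawAt e K B₂ →
      TropRootLawAt (a + e) K ((a + e) ^ c * (B₁ + B₂ + 2)) :=
  ⟨2 * K₀, fun _ _ e B₁ B₂ hK hKa _ _ _ _ => tropRootLawAt_doubled_of_bounded_classes K₀ e hK hKa B₁ B₂⟩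

/-- **EVERY FIXED-CLASS TRUNCATION OF `stub_doublingFromSq` IS SLOPE COUNTING.**  For every `K₀` there is `c` (namely `2K₀`) such that the body of
the signed balanced doubling law from size `K²` on holds for all `K ≤ K₀` (`K ≤ K² ≤ a`).  (The registered stub asks for ONE `c` for ALL `K` and is
NOT proved here.) [this work] -/
theorem doublingFromSq_bounded_classes (K₀ : ℕ) :
    ∃ c : ℕ, ∀ (K a e B₁ B₂ : ℕ), K ≤ K₀ → K ^ 2 ≤ a → a ≤ e → e ≤ a + 1 → TropRootLawAt a K B₁ → TropRootLawAt e K B₂ →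
      TropRootLawAt (a + e) K ((a + e) ^ c * (B₁ + B₂ + 2)) := by
  refine ⟨2 * K₀, fun K a e B₁ B₂ hK hKa _ _ _ _ => ?_⟩
  have hKa' : K ≤ a := le_trans (by nlinarith : K ≤ K ^ 2) hKa
  exact tropRootLawAt_doubled_of_bounded_classes K₀ e hK hKa' B₁ B₂

end BoundedClasses

end Summit.ValiantsHypothesis.ValiantsHypothesis.Theorems.KPlusLogSqLaw.Doubling
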